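import Mathlib
import Summits.AnomalousDissipation.AnomalousDissipation.Theorems.SoloBlindRecessiveTwoPoint
import Summits.AnomalousDissipation.AnomalousDissipation.Theorems.SoloBlindJacobiTwoPoint

/-!
# The truncated weighted two-point certificate (kernel #238, lemmaR-A3 §8(aa), roll side)

Weighted (Jacobi / self-adjoint form) analogue of `SoloBlindTruncatedTwoPoint`: for a three-term
recurrence `a (k+1) u (k+2) + b (k+1) u (k+1) + d (k+1) u k = 0` with symmetriser `p`
(`p (k+1) a (k+1) = A (k+1)`, `p (k+1) d (k+1) = A k`) the weighted Casoratian
`wC j = A j (u j W (j+1) - W j u (j+1))` against a comparison sequence `W` with defects `τ` satisfies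
the tail identity `wcasoratian_tail` (kernel #236).  At a FINITE truncation index `M` this gives
`‖wC j‖ ≤ S · T̂ʷ j` with the certified majorant

  `truncTw A W p τ M j = Σ_{j ≤ i < M} ‖p (i+1)‖ ‖τ (i+1)‖ + ‖A M‖ (‖W M‖ + ‖W (M+1)‖)`,

`S = sup ‖u‖` on `[0, M+1]`, and hence the packaged ROLL CERTIFICATE THEOREM: profile bound `B`,
truncated contraction functional `≤ θ < 1` on `[0, K]` ⟹ `S ≤ ‖u 0‖ B / (1 - θ)` and the datum
transfer `‖u 1 - u 0 W 1‖ ≤ S · T̂ʷ 0 / ‖A 0‖`.  This is exactly the statement fed by the roll half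
of the Arb certificate work/cert_s94/cert_L12.py (sites re-indexed so that the matching row `n = 2`
becomes `k = 0`; weights `p n = 6/((n-1)n(n+1))`, `A n = 6/(n(n+1))`).
-/

namespace Summit.AnomalousDissipation.AnomalousDissipation.Theorems

open Complex

/-- The truncated weighted Casoratian majorant
`T̂ʷ j = Σ_{j ≤ i < M} ‖p (i+1)‖ ‖τ (i+1)‖ + ‖A M‖ (‖W M‖ + ‖W (M+1)‖)`. -/
noncomputable def truncTw (A W p τ : ℕ → ℂ) (M j : ℕ) : ℝ :=
  (Finset.Ico j M).sum (fun i => ‖p (i + 1)‖ * ‖τ (i + 1)‖) + ‖A M‖ * (‖W M‖ + ‖W (M + 1)‖)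

/-- The truncated weighted majorant is non-negative. -/
theorem truncTw_nonneg (A W p τ : ℕ → ℂ) (M j : ℕ) : 0 ≤ truncTw A W p τ M j := by
  unfold truncTw
  have := Finset.sum_nonneg (s := Finset.Ico j M) (f := fun i => ‖p (i + 1)‖ * ‖τ (i + 1)‖)
    (fun i _ => mul_nonneg (norm_nonneg _) (norm_nonneg _))
  positivity

/-- TRUNCATED WEIGHTED CASORATIAN BOUND: `‖wC j‖ ≤ S · T̂ʷ j` for `j ≤ M`. -/
theorem wcasoratian_trunc_bound (A p a b d u W τ : ℕ → ℂ) (M : ℕ) (S : ℝ)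
    (hpa : ∀ k, p (k + 1) * a (k + 1) = A (k + 1)) (hpd : ∀ k, p (k + 1) * d (k + 1) = A k)
    (hu : ∀ k, k + 1 ≤ M → a (k + 1) * u (k + 2) + b (k + 1) * u (k + 1) + d (k + 1) * u k = 0)
    (hW : ∀ k, k + 1 ≤ M →
      a (k + 1) * W (k + 2) + b (k + 1) * W (k + 1) + d (k + 1) * W k = τ (k + 1))
    (hS : ∀ i, i ≤ M + 1 → ‖u i‖ ≤ S)
    (j : ℕ) (hj : j ≤ M) :
    ‖wcasoratian A u W j‖ ≤ S * truncTw A W p τ M j := by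
  have htail := wcasoratian_tail A p a b d u W τ M hpa hpd hu hW j hj
  have hIco : (Finset.range M).sum (fun i => p (i + 1) * u (i + 1) * τ (i + 1))
      - (Finset.range j).sum (fun i => p (i + 1) * u (i + 1) * τ (i + 1))
      = (Finset.Ico j M).sum (fun i => p (i + 1) * u (i + 1) * τ (i + 1)) :=
    (Finset.sum_Ico_eq_sub _ hj).symm
  rw [hIco] at htail
  have hCM : ‖wcasoratian A u W M‖ ≤ S * (‖A M‖ * (‖W M‖ + ‖W (M + 1)‖)) := by
    unfold wcasoratian
    rw [norm_mul]
    have hin : ‖u M * W (M + 1) - W M * u (M + 1)‖ ≤ S * (‖W M‖ + ‖W (M + 1)‖) := by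
      calc ‖u M * W (M + 1) - W M * u (M + 1)‖
          ≤ ‖u M * W (M + 1)‖ + ‖W M * u (M + 1)‖ := norm_sub_le _ _
        _ = ‖u M‖ * ‖W (M + 1)‖ + ‖W M‖ * ‖u (M + 1)‖ := by rw [norm_mul, norm_mul]
        _ ≤ S * ‖W (M + 1)‖ + ‖W M‖ * S :=
            add_le_add (mul_le_mul_of_nonneg_right (hS M (by omega)) (norm_nonneg _))
              (mul_le_mul_of_nonneg_left (hS (M + 1) le_rfl) (norm_nonneg _))
        _ = S * (‖W M‖ + ‖W (M + 1)‖) := by ring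
    calc ‖A M‖ * ‖u M * W (M + 1) - W M * u (M + 1)‖
        ≤ ‖A M‖ * (S * (‖W M‖ + ‖W (M + 1)‖)) := mul_le_mul_of_nonneg_left hin (norm_nonneg _)
      _ = S * (‖A M‖ * (‖W M‖ + ‖W (M + 1)‖)) := by ring
  have hsum : ‖(Finset.Ico j M).sum (fun i => p (i + 1) * u (i + 1) * τ (i + 1))‖
      ≤ S * (Finset.Ico j M).sum (fun i => ‖p (i + 1)‖ * ‖τ (i + 1)‖) := by
    calc ‖(Finset.Ico j M).sum (fun i => p (i + 1) * u (i + 1) * τ (i + 1))‖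
        ≤ (Finset.Ico j M).sum (fun i => ‖p (i + 1) * u (i + 1) * τ (i + 1)‖) := norm_sum_le _ _
      _ ≤ (Finset.Ico j M).sum (fun i => S * (‖p (i + 1)‖ * ‖τ (i + 1)‖)) := by
          apply Finset.sum_le_sum
          intro i hi
          rw [Finset.mem_Ico] at hi
          rw [norm_mul, norm_mul]
          have hui := hS (i + 1) (by omega)
          have : ‖p (i + 1)‖ * ‖u (i + 1)‖ * ‖τ (i + 1)‖ ≤ ‖p (i + 1)‖ * S * ‖τ (i + 1)‖ :=
            mul_le_mul_of_nonneg_right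
              (mul_le_mul_of_nonneg_left hui (norm_nonneg _)) (norm_nonneg _)
          linarith
      _ = S * (Finset.Ico j M).sum (fun i => ‖p (i + 1)‖ * ‖τ (i + 1)‖) := by
          rw [Finset.mul_sum]
  rw [htail]
  calc ‖wcasoratian A u W M - (Finset.Ico j M).sum (fun i => p (i + 1) * u (i + 1) * τ (i + 1))‖
      ≤ ‖wcasoratian A u W M‖
          + ‖(Finset.Ico j M).sum (fun i => p (i + 1) * u (i + 1) * τ (i + 1))‖ := norm_sub_le _ _
    _ ≤ S * (‖A M‖ * (‖W M‖ + ‖W (M + 1)‖))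
          + S * (Finset.Ico j M).sum (fun i => ‖p (i + 1)‖ * ‖τ (i + 1)‖) := add_le_add hCM hsum
    _ = S * truncTw A W p τ M j := by unfold truncTw; ring

/-- TRUNCATED WEIGHTED TWO-POINT ESTIMATE: for `k ≤ K ≤ M`,
`‖u k - u 0 W k‖ ≤ S · ‖W k‖ Σ_{j<k} T̂ʷ j / (‖A j‖ ‖W j‖ ‖W (j+1)‖)`. -/
theorem wtwo_point_estimate_trunc (A p a b d u W τ : ℕ → ℂ) (K M : ℕ) (S : ℝ) (hKM : K ≤ M)
    (hpa : ∀ k, p (k + 1) * a (k + 1) = A (k + 1)) (hpd : ∀ k, p (k + 1) * d (k + 1) = A k)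
    (hu : ∀ k, k + 1 ≤ M → a (k + 1) * u (k + 2) + b (k + 1) * u (k + 1) + d (k + 1) * u k = 0)
    (hW : ∀ k, k + 1 ≤ M →
      a (k + 1) * W (k + 2) + b (k + 1) * W (k + 1) + d (k + 1) * W k = τ (k + 1))
    (hS : ∀ i, i ≤ M + 1 → ‖u i‖ ≤ S)
    (hA : ∀ j, j ≤ K → A j ≠ 0) (hWz : ∀ j, j ≤ K → W j ≠ 0) (hW0 : W 0 = 1)
    (k : ℕ) (hk : k ≤ K) :
    ‖u k - u 0 * W k‖
      ≤ S * (‖W k‖ * (Finset.range k).sum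
          (fun j => truncTw A W p τ M j / (‖A j‖ * ‖W j‖ * ‖W (j + 1)‖))) := by
  have h := wtwo_point_estimate A u W K hA hWz hW0 k hk
  have hterm : ∀ j ∈ Finset.range k,
      ‖wcasoratian A u W j‖ / (‖A j‖ * ‖W j‖ * ‖W (j + 1)‖)
        ≤ S * truncTw A W p τ M j / (‖A j‖ * ‖W j‖ * ‖W (j + 1)‖) := by
    intro j hj
    rw [Finset.mem_range] at hj
    exact div_le_div_of_nonneg_right
      (wcasoratian_trunc_bound A p a b d u W τ M S hpa hpd hu hW hS j (by omega)) (by positivity)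
  have hsum := Finset.sum_le_sum hterm
  calc ‖u k - u 0 * W k‖
      ≤ ‖W k‖ * (Finset.range k).sum
          (fun j => ‖wcasoratian A u W j‖ / (‖A j‖ * ‖W j‖ * ‖W (j + 1)‖)) := h
    _ ≤ ‖W k‖ * (Finset.range k).sum
          (fun j => S * truncTw A W p τ M j / (‖A j‖ * ‖W j‖ * ‖W (j + 1)‖)) :=
        mul_le_mul_of_nonneg_left hsum (norm_nonneg _)
    _ = S * (‖W k‖ * (Finset.range k).sum
          (fun j => truncTw A W p τ M j / (‖A j‖ * ‖W j‖ * ‖W (j + 1)‖))) := by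
        rw [Finset.mul_sum, Finset.mul_sum, Finset.mul_sum]
        apply Finset.sum_congr rfl
        intro j _
        ring

/-- THE ROLL (WEIGHTED) CERTIFICATE THEOREM.  Hypotheses: the symmetrised recurrence on rows
`1 … M`; `S` bounds `‖u‖` on `[0, M+1]` and is attained at some `k ≤ K` (Pringsheim,
`pringsheim_monotone_gen`); `A` and `W` zero-free on `[0, K]`, `W 0 = 1`, `‖W k‖ ≤ B` and the
truncated weighted contraction functional `≤ θ < 1` on `[0, K]`, `K ≤ M`.  Conclusions:
`S ≤ ‖u 0‖ B / (1 - θ)` and `‖u 1 - u 0 W 1‖ ≤ S · T̂ʷ 0 / ‖A 0‖`. -/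
theorem roll_certificate (A p a b d u W τ : ℕ → ℂ) (K M : ℕ) (S B θ : ℝ)
    (hKM : K ≤ M) (hθ : θ < 1)
    (hpa : ∀ k, p (k + 1) * a (k + 1) = A (k + 1)) (hpd : ∀ k, p (k + 1) * d (k + 1) = A k)
    (hu : ∀ k, k + 1 ≤ M → a (k + 1) * u (k + 2) + b (k + 1) * u (k + 1) + d (k + 1) * u k = 0)
    (hW : ∀ k, k + 1 ≤ M →
      a (k + 1) * W (k + 2) + b (k + 1) * W (k + 1) + d (k + 1) * W k = τ (k + 1))
    (hS : ∀ i, i ≤ M + 1 → ‖u i‖ ≤ S) (hSatt : ∃ k, k ≤ K ∧ S ≤ ‖u k‖)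
    (hA : ∀ j, j ≤ K → A j ≠ 0) (hWz : ∀ j, j ≤ K → W j ≠ 0) (hW0 : W 0 = 1)
    (hB : ∀ k, k ≤ K → ‖W k‖ ≤ B)
    (hΘ : ∀ k, k ≤ K → ‖W k‖ * (Finset.range k).sum
        (fun j => truncTw A W p τ M j / (‖A j‖ * ‖W j‖ * ‖W (j + 1)‖)) ≤ θ) :
    S ≤ ‖u 0‖ * B / (1 - θ) ∧ ‖u 1 - u 0 * W 1‖ ≤ S * truncTw A W p τ M 0 / ‖A 0‖ := by
  have hS0 : 0 ≤ S := (norm_nonneg _).trans (hS 0 (by omega))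
  constructor
  · apply nonresonance_apriori u W K S B θ hθ hB hSatt
    intro k hk
    have h1 := wtwo_point_estimate_trunc A p a b d u W τ K M S hKM hpa hpd hu hW hS hA hWz hW0 k hk
    have h2 : S * (‖W k‖ * (Finset.range k).sum
        (fun j => truncTw A W p τ M j / (‖A j‖ * ‖W j‖ * ‖W (j + 1)‖))) ≤ S * θ :=
      mul_le_mul_of_nonneg_left (hΘ k hk) hS0
    rw [mul_comm θ S]
    exact h1.trans h2
  · have hA0 : A 0 ≠ 0 := hA 0 (by omega)
    have hA0n : 0 < ‖A 0‖ := norm_pos_iff.mpr hA0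
    have hC0 : u 1 - u 0 * W 1 = - wcasoratian A u W 0 / A 0 := by
      unfold wcasoratian
      rw [hW0]
      field_simp
      ring
    rw [hC0, norm_div, norm_neg]
    exact div_le_div_of_nonneg_right
      (wcasoratian_trunc_bound A p a b d u W τ M S hpa hpd hu hW hS 0 (by omega)) hA0n.le

end Summit.AnomalousDissipation.AnomalousDissipation.Theorems
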